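import Summits.QuantumFields.YangMills.Theorems.BalabanUVNodesClustersCore
import Literature.MathematicalPhysics.QuantumFieldTheory.Balaban1983to89.Node00.CarriersY
import Literature.MathematicalPhysics.QuantumFieldTheory.Balaban1983to89.Node00.N03Record

/-!
# BalabanUVNodes ∕ N08 at the [B10] PIN OF RECORD `Node00.IsRecordOfRecord₉CB10` — N08's census twin (plan's (W2) «closers of record»):
# the stub `YMDAG.UVSplit.S_N08 Rec := AtRecord Rec Dag.B10_main` READ and CLOSED BY NAME over node00-def g29's Stage-4 «X.B10» carrier pin
# (`Node00/CarriersB10.lean`), with the supplier face towards the d = 3 lane's END theorem and the inhabitation ∕ vacuity guards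
# (Track A, DAG node N08 [Balaban1985UV3] CMP 102 (1985) 255, Thm 1 p. 257 (compact reading) + Thm 2 p. 272; cluster K3; KNIT-BY-NAME seat
# `pub-ymgap-dag-n08-a`, REACTIVATE №3 ∕ director LINE №47, 2026-08-26)

HONEST FRAMING.  Count-neutral kernel bookkeeping BY NAME over LANDED modules: `Node00.CarriersB10` (`PrintedUV3V`, `TFamily₃`, `IsRecordOfRecord₉CB10`,
`leaf_b10_iff_of_isRecordOfRecord₉CB10`, `b10_main_of∕_iff_of_isRecordOfRecord₉CB10`, `atWorld_of_isRecordOfRecord₉CB10`, `isRecordOfRecord₉C_of_isRecordOfRecord₉CB10`,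
`isRecordOfRecord₉CB10_rebind_of_isRecordOfRecord₉C`), `Node00.CarriersY` (`isRecordOfRecord₉CB10_of_isRecordOfRecord₉CB10Y`), this seat's `B10RunsOfRecord` §7–§8
(`PrintedUV3G`, `UniformLeafSystemsG`, `runObjects₀T`, `Backgrounds.ofPrint`, `printedUV3G_of_uniformLeafSystems`), NODE 00's ₅C in-edge theorems
(`b4∕b5∕b7_main_of_isRecordOfRecord₅C`, `N03_at_record₅C`).  NOT A DISCHARGE OF N08: every closer of §2 takes AS HYPOTHESIS the node's object gap — the slot of
record `Node00.PrintedUV3V N L` («SOME version of print's transformations (2) carries [Balaban1985UV3] Thm 1 (compact reading) ∧ Thm 2 with their printed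
∃-prefix, on SU(N), block size `L`»), TYPED, NOT ASSERTED, EXACTLY as g29 typed it — and the ∀-form over `IsRecordOfRecord₉CB10` before an instance of that slot
lands is NOT-A-DISCHARGE (chair R447 guard; A1 = INHABITED-AT-₉C, and `Record9Inhabited` is NODE 00 ∕ W00's K0, not claimed here: §4 only proves
«inhabited at ₉CB10 ⟺ inhabited at ₉C»).  `Node00.tOfRecord₃` (the `Classical.choose` of the slot) appears in NO closer as a witness (it witnesses the slot only if
the slot holds — `Node00.printedUV3G_tOfRecord₃_iff`; circular as a supplier).  Nothing of Bałaban's asserted; the d = 3 lattices of [B10] inside the d = 4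
record, one finite torus per run at fixed spacing; nothing continuum ∕ ℝ³ ∕ ℝ⁴ ∕ infinite volume ∕ OS ∕ mass gap ∕ Clay.  0 `sorry`, 0 `def`, 0 `instance`,
standard axioms.  Filed `--supports` item `StabilityBAtRecord` (stmt-QuantumFields-19183) of route «BalabanUVNodes».

WHAT THIS FILE PROVES.
* §1 READING — `s_N08_iff` (`Iff.rfl`), `s_N08_antitone`; `s_N08_iff₉CB10_faces`: `S_N08 (₉CB10)` ⟺ «at every ₉CB10 record, at ITS block size `L` (`w.L = L`), at
  every run: `b5 → b6 → b7 → b8 → b9 → b11 → PrintedUV3V N L`» (g29's `b10_main_iff_of_isRecordOfRecord₉CB10` BY NAME, no new face); the in-edge guards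
  `guards_of_isRecordOfRecord₉CB10` (`b4 b5 b6 b7` HOLD at every run of every ₉CB10 record — N01 ∕ N02 ∕ N03 ∕ N04 are NODE 00 theorems at the ₅C shadow) and
  hence the EXACT residual reading `s_N08_iff₉CB10`: `S_N08 (₉CB10)` ⟺ «… `b8 → b9 → b11 → PrintedUV3V N L`» (the leaves `b8 b9 b11` read the still-residual
  [B8] ∕ [B9] ∕ [B11] groups and are NOT asserted).
* §2 CLOSERS BY NAME — `s_N08_of_refines₉CB10` (every `Rec` refining ₉CB10, from the ONE declared socket `∀ L, Odd L → 1 < L → Node00.PrintedUV3V N L`),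
  `s_N08_record₉CB10_of_printedUV3V` (₉CB10 itself), the per-record instances `…_at` (the socket asked only at the block sizes the records present), and the
  cumulative-pin instance `s_N08_record₉CB10Y_of_printedUV3V` (node00-def g29's `Node00/CarriersY.lean`, by refinement).  Binder whitelist: the world predicate +
  that socket; no `Consts`, no `Adm`, no leaf system, no chosen `𝔗` on any closer.
* §3 THE SUPPLIER FACE — `printedUV3V_of_printedUV3G_at 𝔗` (∃-introduction into the slot) and `printedUV3V_of_uniformLeafSystems_at 𝔗`: for ANY version
  `𝔗 : Node00.TFamily₃ N L` of print's transformations, admissible ∃-constants with uniform leaf systems on print's runs over `runObjects₀T N 𝔗 (Backgrounds.ofPrint N L)`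
  (EXACTLY the antecedent of `B10RunsOfRecord.printedUV3G_of_uniformLeafSystems` there) give `Node00.PrintedUV3V N L`.  COUNT SENTENCE: N08 becomes count-ready
  the day a lane END theorem (E3 ∕ pub-balaban3d, at a version-selected or continuous `𝔗⋆`) inhabits this hypothesis for every odd `L > 1`; then
  `S_N08 (IsRecordOfRecord₉CB10 F N)` follows from `s_N08_record₉CB10_of_printedUV3V` by `exact`, and «DISCHARGE CLAIMED n08» becomes postable (chair books;
  R417 reads).  Not before.
* §4 GUARDS — `inhabited₉CB10_iff_inhabited₉C` (the pin adds no proviso: INHABITED-AT-₉CB10 on a family ⟺ INHABITED-AT-₉C there = W00's K0, neither side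
  claimed) and `printedUV3V_of_s_N08_record₉CB10` (under inhabitation the ∀-form closer reads the slot back at every presented, guarded block size — it proves
  nothing weaker than the object gap); no `.mk` of a record, no instance, no witness built from `tOfRecord₃`.

WATCH (faithfulness of the background instance, repeated from the seat's HANDOFF).  `Backgrounds.ofPrint` = the plaquette-only class `bgReg3` with def-B's
`Classical.choose` minimiser idiom read at d = 3 (₈a idiom) — a convenience instance meeting condition (h) by construction (`B10RunsOfRecord.isBackground_Uk3`,
`isMinimalConfig_T_ofPrint`); the print-faithful d = 3 instance minimises over [Balaban1985Variational]'s class ((2) ∧ (3)) read at d = 3.  When a `Params`-generic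
`InUkClass` ∕ `Uk` lands (def-B ∕ n07-a ∕ n01-b), a `Backgrounds.ofB11` and bridge lemmas are a v1.2 of `B10RunsOfRecord` (everything in its §3–§8 is generic in
`𝔅` already); the slot of record and this file then re-point by one `rfl`-bridge, not by re-proof.
-/

noncomputable section

namespace Summit.QuantumFields.YangMills.BalabanUVNodes.N08AtRecord9CB10

open Literature.MathematicalPhysics.QuantumFieldTheory.Balaban1983to89
open Literature.MathematicalPhysics.QuantumFieldTheory.Balaban1983to89.T4Continuum (T4Family FiniteEpsData)
open Literature.MathematicalPhysics.QuantumFieldTheory.Balaban1983to89.DagBinding (WorldP leavesP)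
open Literature.MathematicalPhysics.QuantumFieldTheory.Balaban1983to89.Node00
open Literature.MathematicalPhysics.QuantumFieldTheory.Balaban1983to89.B10RunsOfRecord
  (Consts UniformLeafSystemsG PrintedUV3G runObjects₀T Backgrounds printedUV3G_of_uniformLeafSystems)
open YMDAG.UVSplit (RecordPred Datum AtRecord S_N08)

variable {N : ℕ} [NeZero N]

/-! ## §1 READING — the stub unfolded; antitone; N08 at a ₉CB10 record by g29's faces; the in-edge guards; the exact residual reading -/

/-- **What `S_N08 Rec` says** (`Iff.rfl`): at every run of every binding world of every record pair, `Dag.B10_main` — «in-edges `b5 b6 b7 b8 b9 b11` ⇒ the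
`b10` leaf the record's binding carries». [cite: Balaban1985UV3, Thm 1 p.257 and Thm 2 p.272 (the node's content; bookkeeping)] -/
theorem s_N08_iff (Rec : RecordPred N) :
    S_N08 Rec ↔ ∀ (F : T4Family) (D : Datum F N) (w : WorldP), Rec F D w → ∀ P : B12.RunParams, Dag.B10_main (leavesP w P) :=
  Iff.rfl

/-- **`S_N08` is ANTITONE in the record predicate**: proved at `Rec`, it holds at every `Rec'` refining `Rec`. [cite: Balaban1985UV3, Thm 1 p.257 (bookkeeping)] -/
theorem s_N08_antitone {Rec Rec' : RecordPred N}
    (hle : ∀ (F : T4Family) (D : Datum F N) (w : WorldP), Rec' F D w → Rec F D w) (h : S_N08 Rec) : S_N08 Rec' :=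
  fun F D w hR P => h F D w (hle F D w hR) P

/-- **`S_N08` AT THE [B10] PIN OF RECORD, READ BY g29's FACES** (`Node00.b10_main_iff_of_isRecordOfRecord₉CB10` by name, no new face): `S_N08 (IsRecordOfRecord₉CB10 F N)`
⟺ «at every ₉CB10 record, at its block size `L` (`w.L = L`, Bałaban's `L`), at every run, the in-edge leaves imply the SLOT OF RECORD `Node00.PrintedUV3V N L`».
[cite: Balaban1985UV3, Thm 1 p.257 (compact reading) and Thm 2 p.272] -/
theorem s_N08_iff₉CB10_faces :
    S_N08 (fun F D w => IsRecordOfRecord₉CB10 F N D w) ↔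
      ∀ (F : T4Family) (D : Datum F N) (w : WorldP), IsRecordOfRecord₉CB10 F N D w → ∀ L : ℕ, w.L = (L : ℝ) →
        ∀ P : B12.RunParams, (leavesP w P).b5 → (leavesP w P).b6 → (leavesP w P).b7 → (leavesP w P).b8 → (leavesP w P).b9 →
          (leavesP w P).b11 → PrintedUV3V N L := by
  refine ⟨fun hS F D w h L hL P => ?_, fun H F D w h P => ?_⟩
  · obtain ⟨L₀, -, hL₀, hiff⟩ := b10_main_iff_of_isRecordOfRecord₉CB10 h
    have hLL : L₀ = L := by exact_mod_cast hL₀.symm.trans hL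
    subst hLL
    exact (hiff P).1 (hS F D w h P)
  · obtain ⟨L₀, -, hL₀, hiff⟩ := b10_main_iff_of_isRecordOfRecord₉CB10 h
    exact (hiff P).2 (H F D w h L₀ hL₀ P)

section Guards

variable {F : T4Family} {D : Datum F N} {w : WorldP}

/-- **In-edge guards at every run of a ₉CB10 record**: the leaves `b4`, `b5`, `b6`, `b7` HOLD — N01, N02, N03, N04 are NODE 00 theorems at the Stage-5 shadow
(`Node00.b4∕b5∕b7_main_of_isRecordOfRecord₅C`, `Node00.N03_at_record₅C`), transferred to the pinned Stage-9 record by `Node00.atWorld_of_isRecordOfRecord₉CB10`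
(same world).  So no closer of this file is vacuous through `b5 b6 b7`; the leaves `b8 b9 b11` read the residual [B8] ∕ [B9] ∕ [B11] groups and are not asserted.
[cite: Balaban1983RegularityDecay, Theorem p.573; Balaban1984PropagatorsI, Props. 1.1–1.2 pp.33–36; Balaban1984PropagatorsII, Lemma 2.1 – Cor. 2.8 pp.234–249; Balaban1985Averaging, Props. 1–10 pp.26–50 (kernel versions at the objects of record; bookkeeping, transferred)] -/
theorem guards_of_isRecordOfRecord₉CB10 (h : IsRecordOfRecord₉CB10 F N D w) (P : B12.RunParams) :
    (leavesP w P).b4 ∧ (leavesP w P).b5 ∧ (leavesP w P).b6 ∧ (leavesP w P).b7 :=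
  atWorld_of_isRecordOfRecord₉CB10 (X := fun ℓ => ℓ.b4 ∧ ℓ.b5 ∧ ℓ.b6 ∧ ℓ.b7)
    (fun _ _ h5 Q =>
      have h4 := b4_main_of_isRecordOfRecord₅C h5 Q
      have h5' := b5_main_of_isRecordOfRecord₅C h5 Q h4
      ⟨h4, h5', N03_at_record₅C h5 Q h4 h5', b7_main_of_isRecordOfRecord₅C h5 Q h5'⟩)
    h P

/-- **N08 at a ₉CB10 record, the EXACT RESIDUAL READING**: with `L` the world's block size, at every run `Dag.B10_main ⟺ (b8 → b9 → b11 → PrintedUV3V N L)` —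
the three discharged in-edges `b5 b6 b7` drop out (guards above); `b8 b9 b11` stay displayed. [cite: Balaban1985UV3, Thm 1 p.257 (compact reading) and Thm 2 p.272 (bookkeeping)] -/
theorem b10_main_iff_residual_of_isRecordOfRecord₉CB10 (h : IsRecordOfRecord₉CB10 F N D w) :
    ∃ L : ℕ, (Odd L ∧ 1 < L) ∧ w.L = (L : ℝ) ∧ ∀ P : B12.RunParams,
      (Dag.B10_main (leavesP w P) ↔ ((leavesP w P).b8 → (leavesP w P).b9 → (leavesP w P).b11 → PrintedUV3V N L)) := by
  obtain ⟨L, hL, hwL, hiff⟩ := b10_main_iff_of_isRecordOfRecord₉CB10 h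
  refine ⟨L, hL, hwL, fun P => ?_⟩
  obtain ⟨-, h5, h6, h7⟩ := guards_of_isRecordOfRecord₉CB10 h P
  rw [hiff P]
  exact ⟨fun H h8 h9 h11 => H h5 h6 h7 h8 h9 h11, fun H _ _ _ h8 h9 h11 => H h8 h9 h11⟩

end Guards

/-- **`S_N08` AT THE [B10] PIN OF RECORD, EXACTLY** (N08's census line at ₉CB10): `S_N08 (IsRecordOfRecord₉CB10 F N)` ⟺ «at every ₉CB10 record, at its block size
`L`, at every run where the residual in-edge leaves `b8 b9 b11` hold, the slot of record `Node00.PrintedUV3V N L`».  Neither side is claimed.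
[cite: Balaban1985UV3, Thm 1 p.257 (compact reading) and Thm 2 p.272] -/
theorem s_N08_iff₉CB10 :
    S_N08 (fun F D w => IsRecordOfRecord₉CB10 F N D w) ↔
      ∀ (F : T4Family) (D : Datum F N) (w : WorldP), IsRecordOfRecord₉CB10 F N D w → ∀ L : ℕ, w.L = (L : ℝ) →
        ∀ P : B12.RunParams, (leavesP w P).b8 → (leavesP w P).b9 → (leavesP w P).b11 → PrintedUV3V N L := by
  refine ⟨fun hS F D w h L hL P h8 h9 h11 => ?_, fun H F D w h P => ?_⟩
  · obtain ⟨L₀, -, hL₀, hiff⟩ := b10_main_iff_residual_of_isRecordOfRecord₉CB10 h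
    have hLL : L₀ = L := by exact_mod_cast hL₀.symm.trans hL
    subst hLL
    exact (hiff P).1 (hS F D w h P) h8 h9 h11
  · obtain ⟨L₀, -, hL₀, hiff⟩ := b10_main_iff_residual_of_isRecordOfRecord₉CB10 h
    exact (hiff P).2 (H F D w h L₀ hL₀ P)

/-! ## §2 CLOSERS BY NAME — from the ONE declared socket `∀ L, Odd L → 1 < L → Node00.PrintedUV3V N L` (N08's object gap), nothing else -/

/-- **`S_N08 Rec` FOR EVERY RECORD PREDICATE REFINING THE [B10] PIN OF RECORD, FROM THE SLOT OF RECORD** (g29's `Node00.b10_main_of_isRecordOfRecord₉CB10` BY NAME;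
in-edges unused).  The hypothesis `hUV` IS N08's object gap — [Balaban1985UV3] Thm 1 (compact) ∧ Thm 2 at some version of print's transformations, every odd
`L > 1` —; NOT-A-DISCHARGE until it is inhabited. [cite: Balaban1985UV3, Thm 1 p.257 (compact reading) and Thm 2 p.272] -/
theorem s_N08_of_refines₉CB10 (Rec : RecordPred N)
    (href : ∀ (F : T4Family) (D : Datum F N) (w : WorldP), Rec F D w → IsRecordOfRecord₉CB10 F N D w)
    (hUV : ∀ L : ℕ, Odd L → 1 < L → PrintedUV3V N L) : S_N08 Rec :=
  fun F D w hR P => b10_main_of_isRecordOfRecord₉CB10 hUV (href F D w hR) P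

/-- **`S_N08` AT THE [B10] PIN OF RECORD ITSELF, FROM THE SLOT OF RECORD** — the ∀-form closer of record for N08 (NOT-A-DISCHARGE before an instance of the slot
lands; chair R447 guard). [cite: Balaban1985UV3, Thm 1 p.257 (compact reading) and Thm 2 p.272] -/
theorem s_N08_record₉CB10_of_printedUV3V (hUV : ∀ L : ℕ, Odd L → 1 < L → PrintedUV3V N L) :
    S_N08 (fun F D w => IsRecordOfRecord₉CB10 F N D w) :=
  s_N08_of_refines₉CB10 _ (fun _ _ _ h => h) hUV

/-- **Per-record instance of the socket**: `S_N08 Rec` for every `Rec` refining ₉CB10 from the slot of record asked ONLY at the block sizes the records of `Rec`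
present (`w.L = L`; g29's `Node00.leaf_b10_iff_of_isRecordOfRecord₉CB10` BY NAME). [cite: Balaban1985UV3, Thm 1 p.257 (compact reading) and Thm 2 p.272] -/
theorem s_N08_of_refines₉CB10_at (Rec : RecordPred N)
    (href : ∀ (F : T4Family) (D : Datum F N) (w : WorldP), Rec F D w → IsRecordOfRecord₉CB10 F N D w)
    (hUV : ∀ (F : T4Family) (D : Datum F N) (w : WorldP), Rec F D w → ∀ L : ℕ, w.L = (L : ℝ) → PrintedUV3V N L) :
    S_N08 Rec := by
  intro F D w hR P
  obtain ⟨L, -, hwL, hiff⟩ := leaf_b10_iff_of_isRecordOfRecord₉CB10 (href F D w hR)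
  exact fun _ _ _ _ _ _ => (hiff P).2 (hUV F D w hR L hwL)

/-- … and at ₉CB10 itself. [cite: Balaban1985UV3, Thm 1 p.257 (compact reading) and Thm 2 p.272] -/
theorem s_N08_record₉CB10_of_printedUV3V_at
    (hUV : ∀ (F : T4Family) (D : Datum F N) (w : WorldP), IsRecordOfRecord₉CB10 F N D w → ∀ L : ℕ, w.L = (L : ℝ) → PrintedUV3V N L) :
    S_N08 (fun F D w => IsRecordOfRecord₉CB10 F N D w) :=
  s_N08_of_refines₉CB10_at _ (fun _ _ _ h => h) hUV

/-- **The cumulative-pin instance**: `S_N08` at node00-def g29's Stage-3′(Y) record `Node00.IsRecordOfRecord₉CB10Y` ([B9] group pinned on top of the [B10] pin;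
`Node00.isRecordOfRecord₉CB10_of_isRecordOfRecord₉CB10Y` BY NAME), from the same socket — the [B10] face survives every later carrier pin by refinement.
[cite: Balaban1985UV3, Thm 1 p.257 (compact reading) and Thm 2 p.272] -/
theorem s_N08_record₉CB10Y_of_printedUV3V (hUV : ∀ L : ℕ, Odd L → 1 < L → PrintedUV3V N L) :
    S_N08 (fun F D w => IsRecordOfRecord₉CB10Y F N D w) :=
  s_N08_of_refines₉CB10 _ (fun _ _ _ h => isRecordOfRecord₉CB10_of_isRecordOfRecord₉CB10Y h) hUV

/-! ## §3 THE SUPPLIER FACE — how the slot of record is inhabited (∃-introduction at ANY version `𝔗` of print's transformations), typed not asserted -/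

section Supplier

variable {L : ℕ}

/-- **∃-INTRODUCTION INTO THE SLOT OF RECORD**: the printed theorems (compact Thm 1 ∧ Thm 2 with their ∃-prefix) over print's binders at ANY version
`𝔗 : Node00.TFamily₃ N L` of the transformations (2), with print's own backgrounds, give `Node00.PrintedUV3V N L`. [cite: Balaban1985UV3, Thm 1 p.257 (compact reading) and Thm 2 p.272; Balaban1985Averaging, (10) p.19] -/
theorem printedUV3V_of_printedUV3G_at (𝔗 : TFamily₃ N L) (h : PrintedUV3G N L (runObjects₀T N 𝔗 (Backgrounds.ofPrint N L))) :
    PrintedUV3V N L :=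
  ⟨𝔗, h⟩

/-- **THE SUPPLIER FACE OF N08** (socket for the d = 3 lane's END theorem ∕ the E3 programme): for ANY version `𝔗` of print's transformations, admissible
∃-constants with UNIFORM LEAF SYSTEMS on print's runs over `runObjects₀T N 𝔗 (Backgrounds.ofPrint N L)` — EXACTLY the antecedent of this seat's
`B10RunsOfRecord.printedUV3G_of_uniformLeafSystems` there — give the slot of record.  Usage: `printedUV3V_of_uniformLeafSystems_at 𝔗 ⟨c, hc, h⟩`.  The day a lane END
theorem inhabits this hypothesis at some `𝔗⋆` for every odd `L > 1`, `S_N08 (IsRecordOfRecord₉CB10 F N)` follows from `s_N08_record₉CB10_of_printedUV3V` by `exact`.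
[cite: Balaban1985UV3, Thm 1 p.257, Thm 2 p.272, Sect. D pp.272–275; Balaban1985Averaging, (10) p.19] -/
theorem printedUV3V_of_uniformLeafSystems_at (𝔗 : TFamily₃ N L)
    (h : ∃ c : Consts L, c.Adm ∧ UniformLeafSystemsG N (runObjects₀T N 𝔗 (Backgrounds.ofPrint N L)) c) : PrintedUV3V N L :=
  ⟨𝔗, printedUV3G_of_uniformLeafSystems N L _ h⟩

end Supplier

/-! ## §4 GUARDS — inhabitation of the pinned class is Stage 9's exactly (W00's K0, not claimed here) -/

/-- **INHABITED-AT-₉CB10 ⟺ INHABITED-AT-₉C, family by family** (the carrier pin adds no proviso and no admissibility clause: refinement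
`Node00.isRecordOfRecord₉C_of_isRecordOfRecord₉CB10` one way, re-binding `Node00.isRecordOfRecord₉CB10_rebind_of_isRecordOfRecord₉C` — same datum, world re-bound by the
pinned C-binding — the other).  The A1 guard of any future N08 count line is therefore NODE 00 ∕ W00's `Record9Inhabited` (K0), neither proved nor assumed in
this file. [cite: Balaban1989LargeFieldII, Thm 1 + (0.1) pp.355–356 (objects of record; bookkeeping)] -/
theorem inhabited₉CB10_iff_inhabited₉C (F : T4Family) :
    (∃ (D : Datum F N) (w : WorldP), IsRecordOfRecord₉CB10 F N D w) ↔
      ∃ (D : Datum F N) (w : WorldP), IsRecordOfRecord₉C F N D w := by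
  refine ⟨fun ⟨D, w, h⟩ => ⟨D, w, isRecordOfRecord₉C_of_isRecordOfRecord₉CB10 h⟩, fun ⟨D, w, h⟩ => ?_⟩
  obtain ⟨θ, _, -, -, h10⟩ := isRecordOfRecord₉CB10_rebind_of_isRecordOfRecord₉C h
  exact ⟨D, _, h10⟩

/-- **Under inhabitation the ∀-form closer is NOT vacuous and reads the slot back**: if `S_N08` holds at the [B10] pin of record and some ₉CB10 record on some
family has block size `L` and a run at which the residual in-edges `b8 b9 b11` hold, then the slot of record `Node00.PrintedUV3V N L` HOLDS — the closers of §2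
prove nothing weaker than the object gap at every presented, guarded block size. [cite: Balaban1985UV3, Thm 1 p.257 (compact reading) and Thm 2 p.272 (bookkeeping)] -/
theorem printedUV3V_of_s_N08_record₉CB10 (hS : S_N08 (fun F D w => IsRecordOfRecord₉CB10 F N D w))
    {F : T4Family} {D : Datum F N} {w : WorldP} (h : IsRecordOfRecord₉CB10 F N D w) {L : ℕ} (hL : w.L = (L : ℝ))
    {P : B12.RunParams} (h8 : (leavesP w P).b8) (h9 : (leavesP w P).b9) (h11 : (leavesP w P).b11) : PrintedUV3V N L :=
  s_N08_iff₉CB10.1 hS F D w h L hL P h8 h9 h11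

end Summit.QuantumFields.YangMills.BalabanUVNodes.N08AtRecord9CB10

end
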